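import Literature.Probability.LatticeModels.StrongMixingEffectiveness
import HarnessLib

/-!
# Relative densities of finite-volume Gibbs measures under changes of the boundary condition
# ([Mar99] Proposition 2.12), PROVED in event form

Topic `Literature/Probability/LatticeModels`; cell `ym-ir`, seat lit-3 (census rows B2/B4).  Theorems only, no
new named fact (D-0026).  [Mar99] Proposition 2.12 controls the relative density `dμ_A^τ/dμ_A^σ|_{A₀}` on the
spins of a region `A₀ ⊆ A` when the boundary conditions `σ, τ` differ on a set `B₀ ⊆ ∂_r^+ A` far from `A₀`,
assuming decay of covariances (`SMT`) in `A ∖ A₀`: `‖1 − dμ_A^τ/dμ_A^σ|_{A₀}‖_∞ ≤ e^{−(m/4)d₀}`.  We prove it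
in the EVENT form consumed by the tree's [Mar99] Proposition 3.5 (`Glauber.Martinelli1999_prop3_5`, PROVED in
`GlauberTwoBlockGap.lean`): `|μ_A^τ(E) − μ_A^σ(E)| ≤ κ · μ_A^σ(E)` for all `A₀`-local events `E`, and the
two-block form `|μ_A^τ(E) − μ_{A∪B}^τ(E)| ≤ ε · μ_{A∪B}^τ(E)` (hypothesis (3.33) of Proposition 3.5).  This is
the input of [Mar99] Theorems 4.5/4.6 (the typed facts `Glauber.Martinelli1999_thm4_5/4_6`, NOT proved here).
SIBLING-SETTING result (`±1` spins, finite range); nothing here concerns gauge theories or the Yang–Mills gap.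

Source (held; `book:bertoin1999-lectures-probability-theory-statistics`): [Mar99] F. Martinelli, LNM 1717 (1999),
Proposition 2.12 p0163 L41 – p0164 L2, proof p0164 L3–30 ((2.27)–(2.28) and the display after it).
[cite: Martinelli1999, Proposition 2.12]

Contents (printed → here):
* `Glauber.abs_spec_real_spinFlip_sub_le_mul_real` — ONE boundary flip, multiplicatively: for `x ∉ A` with
  `d(x, A₀) > r` and an event `E` reading `A₀` (and possibly sites off `A`, but not `x`),
  `|μ_A^{ζ^x}(E) − μ_A^ζ(E)| ≤ R² (Σ_y c_y) μ_A^ζ(E)`, where `c_y` bounds `|μ_{A∖A₀}^ξ(h_x; h_y)|` over the sites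
  `y ∈ ∂_r^+(A ∖ A₀) ∩ A` (this is the quantity `a` of the printed proof, bounded there through Lemma 2.8; here:
  tilt identity `μ^{ζ^x}(E) μ^ζ(h_x) = μ^ζ(1_E h_x)`, DLR `μ^ζ(1_E h_x) = μ^ζ(1_E μ_{A∖A₀}(h_x))`, and the
  oscillation bound (2.18) for `μ_{A∖A₀}(h_x)`).
* `Glauber.abs_spec_real_sub_le_pow_mul_real` — (2.28): telescoping over the `n` differing boundary sites,
  `|μ_A^τ(E) − μ_A^σ(E)| ≤ ((1+a)^n − 1) μ_A^σ(E)`.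
* `Glauber.abs_spec_real_sub_union_le_mul_real` — the two-block form: `|μ_A^τ(E) − μ_{A∪B}^τ(E)| ≤
  κ/(1−κ) · μ_{A∪B}^τ(E)` with `κ = (1+a)^{|∂_r^+A ∩ B|} − 1 < 1`.
* `Glauber.abs_spec_real_spinFlip_sub_le_mul_real_of_SMT` — the covariance input from `SMT(A ∖ A₀, l, m)`.
* `Glauber.abs_cov_le_of_subvolume`, `Glauber.abs_cov_le_of_SMT_subvolume` — one conditioning step ((2.25) with
  `C = ∅`): the covariance `μ_W^ξ(u; v)` is controlled by the covariances `μ_A^ζ(u; h_z^A)` in ANY sub-volume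
  `A ⊆ W` containing the `W`-part of the support of `u` and avoiding that of `v`; with `SMT(A, l, m)` this gives
  `|μ_W^ξ(u; v)| ≤ ‖u‖‖v‖ R² (2r+1)^{2d} |∂_r^+A ∩ W| e^{−m(ρ−2r)}` — the form in which an `SMT` hypothesis on a
  restricted class of volumes (e.g. the fat rectangles of [Mar99] Theorem 4.5) supplies the input `c_y` above.
* `Glauber.abs_spec_real_sub_union_le_of_local_SMT` — (3.33) for two overlapping blocks `A, B` from `SMT` in
  sub-boxes of the overlap `A ∩ B` only (the form needed in the proof of [Mar99] Theorem 4.5, p0189 L3–7, where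
  the hypothesis gives `SMT` on fat rectangles and the overlap is a thin strip).
-/

open MeasureTheory ProbabilityTheory Finset Filter

noncomputable section

namespace Literature.Probability.LatticeModels

namespace Glauber

variable {d r : ℕ} (U : FRPotential d ℤˣ r) (β : ℝ)

/-- Indicator observables of `T`-local events are `T`-local. [folklore] -/
private theorem dependsOn_indicator {E : Set (Site d → ℤˣ)} {T : Set (Site d)} (hET : DependsOn (· ∈ E) T) :
    DependsOn (E.indicator (1 : (Site d → ℤˣ) → ℝ)) T := fun σ σ' h => by
  have hiff : σ ∈ E ↔ σ' ∈ E := Iff.of_eq (hET h)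
  by_cases hσ : σ ∈ E
  · rw [Set.indicator_of_mem hσ, Set.indicator_of_mem (hiff.1 hσ), Pi.one_apply, Pi.one_apply]
  · rw [Set.indicator_of_notMem hσ, Set.indicator_of_notMem (fun h' => hσ (hiff.2 h'))]

/-- **[Mar99] Proposition 2.12, one boundary flip** (the quantity `a` of the printed proof, p0164 L14–27):
for `A₀ ⊆ A`, `x ∉ A` at distance `> r` from `A₀`, and an event `E` reading only `A₀` inside `A` (and not the
site `x`), `|μ_A^{ζ^x}(E) − μ_A^ζ(E)| ≤ R² (Σ_{y∈∂_r^+(A∖A₀)∩A} c_y) · μ_A^ζ(E)`, where `c_y` bounds the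
covariances `|μ_{A∖A₀}^ξ(h_x^A; h_y^{A∖A₀})|`.  Proof: `μ^{ζ^x}(E) μ^ζ(h_x) = μ^ζ(1_E h_x) = μ^ζ(1_E Φ)`,
`Φ = μ_{A∖A₀}(h_x)`, `|Φ − μ^ζ(h_x)| ≤ R Σ c_y` a.s. by (2.18), and `μ^ζ(h_x) ≥ R⁻¹`.
[cite: Martinelli1999, Proposition 2.12] -/
theorem abs_spec_real_spinFlip_sub_le_mul_real {R : ℝ} (hR1 : 1 ≤ R)
    (hR : ∀ (Λ : Finset (Site d)) (y : Site d) (σ : Site d → ℤˣ),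
      R⁻¹ ≤ flipWeight U β Λ y σ ∧ flipWeight U β Λ y σ ≤ R)
    {A A₀ : Finset (Site d)} {x : Site d} (hxA : x ∉ A) (hxA₀ : ∀ z ∈ A₀, r < supDist z x)
    {E : Set (Site d → ℤˣ)} (hE : MeasurableSet E) {T : Set (Site d)} (hET : DependsOn (· ∈ E) T)
    (hT : ∀ z ∈ T, z ∈ A → z ∈ A₀) (hxT : x ∉ T) {c : Site d → ℝ}
    (hc : ∀ y ∈ (rOuterBoundary r (A \ A₀)).filter (· ∈ A), ∀ ξ : Site d → ℤˣ,
      |∫ ω, flipWeight U β A x ω * flipWeight U β (A \ A₀) y ω ∂(U.spec β (A \ A₀) ξ) -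
        (∫ ω, flipWeight U β A x ω ∂(U.spec β (A \ A₀) ξ)) *
          ∫ ω, flipWeight U β (A \ A₀) y ω ∂(U.spec β (A \ A₀) ξ)| ≤ c y)
    (ζ : Site d → ℤˣ) :
    |(U.spec β A (spinFlip x ζ)).real E - (U.spec β A ζ).real E| ≤
      (R * (R * ∑ y ∈ (rOuterBoundary r (A \ A₀)).filter (· ∈ A), c y)) * (U.spec β A ζ).real E := by
  classical
  have hγ := U.isSpecification_spec β
  haveI := hγ.isProbability A ζ
  haveI := hγ.isProbability A (spinFlip x ζ)
  have hR0 : 0 < R := by linarith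
  set hx := flipWeight U β A x with hhx
  have hxm : Measurable hx := measurable_flipWeight U β A x
  have hxd : DependsOn hx (↑(rNeighbourhood r x) : Set (Site d)) := dependsOn_flipWeight U β A x
  have hxR : ∀ σ, |hx σ| ≤ R := fun σ => by
    rw [hhx, abs_of_pos (flipWeight_pos U β A x σ)]; exact (hR A x σ).2
  have hsub : A \ A₀ ⊆ A := Finset.sdiff_subset
  set S := (rOuterBoundary r (A \ A₀)).filter (· ∈ A) with hS
  set δ : ℝ := R * ∑ y ∈ S, c y with hδ
  -- the indicator observable
  set F : (Site d → ℤˣ) → ℝ := E.indicator 1 with hF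
  have hFm : Measurable F := measurable_one.indicator hE
  have hFd : DependsOn F T := dependsOn_indicator hET
  have hFb : ∀ σ, |F σ| ≤ 1 := fun σ => by
    rw [hF]
    by_cases hσ : σ ∈ E
    · rw [Set.indicator_of_mem hσ]; simp
    · rw [Set.indicator_of_notMem hσ]; simp
  -- tilt identity: `μ^{ζ^x}(E) μ^ζ(h_x) = μ^ζ(1_E h_x)`
  have htilt := integral_spec_spinFlip_mul U β A hxA ζ hFm hFd hxT
  -- DLR: `μ^ζ(1_E h_x) = μ^ζ(1_E Φ)`, `Φ = μ_{A∖A₀}(h_x)`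
  set Φ := bavg (U.spec β) (A \ A₀) hx with hΦ
  have hΦm : Measurable Φ := measurable_bavg hγ _ hxm
  have hΦB : ∀ σ, |Φ σ| ≤ R := abs_bavg_le hγ _ hxR
  have hFT : ∀ z ∈ T, z ∉ A \ A₀ := fun z hz hz' => by
    rw [Finset.mem_sdiff] at hz'
    exact hz'.2 (hT z hz hz'.1)
  have hDLR : ∫ ω, F ω * hx ω ∂(U.spec β A ζ) = ∫ ω, F ω * Φ ω ∂(U.spec β A ζ) := by
    have hb : ∀ σ, |F σ * hx σ| ≤ 1 * R := fun σ => by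
      rw [abs_mul]; exact mul_le_mul (hFb σ) (hxR σ) (abs_nonneg _) zero_le_one
    rw [← integral_integral_spec hγ hsub ζ (h := fun ω => F ω * hx ω) (hFm.mul hxm) hb]
    exact integral_congr_ae (Eventually.of_forall fun σ => bavg_mul_of_dependsOn hγ _ hFd hFT hx σ)
  -- oscillation of `Φ` under `μ_A^ζ`
  have hTx : ∀ z ∈ (↑(rNeighbourhood r x) : Set (Site d)), z ∈ A → z ∈ A \ A₀ := by
    intro z hz hzA
    rw [Finset.mem_sdiff]
    refine ⟨hzA, fun hzA₀ => ?_⟩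
    have h1 : supDist z x ≤ r := mem_rNeighbourhood.1 (Finset.mem_coe.1 hz)
    have h2 := hxA₀ z hzA₀
    omega
  have hosc : ∀ σ σ' : Site d → ℤˣ, (∀ z ∉ A, σ z = σ' z) → |Φ σ - Φ σ'| ≤ δ := fun σ σ' hagree =>
    abs_bavg_sub_bavg_le_sum U β hR1 hR (W := A) (A := A \ A₀) hxm hxd hTx hc σ σ' hagree
  have hae := abs_bavg_sub_integral_le_ae U β hsub ζ hxm hxR hosc
  set m := ∫ ω, hx ω ∂(U.spec β A ζ) with hm
  have hm_pos : R⁻¹ ≤ m := by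
    have h := integral_mono_of_nonneg (μ := U.spec β A ζ) (f := fun _ => R⁻¹) (g := hx)
      (Eventually.of_forall fun _ => by positivity)
      (Integrable.of_bound hxm.aestronglyMeasurable R (Eventually.of_forall fun σ => by
        rw [Real.norm_eq_abs]; exact hxR σ))
      (Eventually.of_forall fun σ => (hR A x σ).1)
    rwa [integral_const, smul_eq_mul, probReal_univ, one_mul] at h
  have hm0 : 0 < m := lt_of_lt_of_le (by positivity) hm_pos
  -- `μ^ζ(1_E Φ) = m μ^ζ(E) + μ^ζ(1_E (Φ − m))`, the last term at most `δ μ^ζ(E)`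
  have hiF : Integrable F (U.spec β A ζ) := Integrable.of_bound hFm.aestronglyMeasurable 1
    (Eventually.of_forall fun σ => by rw [Real.norm_eq_abs]; exact hFb σ)
  have hiFΦ : Integrable (fun ω => F ω * Φ ω) (U.spec β A ζ) :=
    Integrable.of_bound (hFm.mul hΦm).aestronglyMeasurable (1 * R) (Eventually.of_forall fun σ => by
      rw [Real.norm_eq_abs, abs_mul]; exact mul_le_mul (hFb σ) (hΦB σ) (abs_nonneg _) zero_le_one)
  have hFint : ∫ ω, F ω ∂(U.spec β A ζ) = (U.spec β A ζ).real E := by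
    rw [hF]; exact integral_indicator_one hE
  have hiFΦm : Integrable (fun ω => F ω * (Φ ω - m)) (U.spec β A ζ) := by
    refine (hiFΦ.sub (hiF.mul_const m)).congr (Eventually.of_forall fun ω => ?_)
    show F ω * Φ ω - F ω * m = F ω * (Φ ω - m)
    ring
  have hsplit : ∫ ω, F ω * Φ ω ∂(U.spec β A ζ) =
      m * (U.spec β A ζ).real E + ∫ ω, F ω * (Φ ω - m) ∂(U.spec β A ζ) := by
    have e1 : ∫ ω, F ω * Φ ω ∂(U.spec β A ζ) = ∫ ω, (m * F ω + F ω * (Φ ω - m)) ∂(U.spec β A ζ) :=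
      integral_congr_ae (Eventually.of_forall fun ω => by ring)
    rw [e1, integral_add (hiF.const_mul m) hiFΦm, integral_const_mul, hFint]
  have herr : |∫ ω, F ω * (Φ ω - m) ∂(U.spec β A ζ)| ≤ δ * (U.spec β A ζ).real E := by
    have hb : ∀ᵐ ω ∂(U.spec β A ζ), |F ω * (Φ ω - m)| ≤ E.indicator (fun _ => δ) ω := by
      filter_upwards [hae] with ω hω
      rw [abs_mul, hF]
      by_cases hωE : ω ∈ E
      · rw [Set.indicator_of_mem hωE, Set.indicator_of_mem hωE, Pi.one_apply, abs_one, one_mul]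
        exact hω
      · rw [Set.indicator_of_notMem hωE, Set.indicator_of_notMem hωE, abs_zero, zero_mul]
    calc |∫ ω, F ω * (Φ ω - m) ∂(U.spec β A ζ)| ≤ ∫ ω, |F ω * (Φ ω - m)| ∂(U.spec β A ζ) :=
          abs_integral_le_integral_abs
      _ ≤ ∫ ω, E.indicator (fun _ => δ) ω ∂(U.spec β A ζ) :=
          integral_mono_ae hiFΦm.abs ((integrable_const δ).indicator hE) hb
      _ = δ * (U.spec β A ζ).real E := by rw [integral_indicator_const _ hE, smul_eq_mul, mul_comm]
  -- conclude
  have hreal : (U.spec β A (spinFlip x ζ)).real E = ∫ ω, F ω ∂(U.spec β A (spinFlip x ζ)) := by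
    rw [hF, integral_indicator_one hE]
  have key : ((U.spec β A (spinFlip x ζ)).real E - (U.spec β A ζ).real E) * m =
      ∫ ω, F ω * (Φ ω - m) ∂(U.spec β A ζ) := by
    rw [sub_mul, hreal, htilt, hDLR, hsplit]
    ring
  have habs : |(U.spec β A (spinFlip x ζ)).real E - (U.spec β A ζ).real E| * m ≤ δ * (U.spec β A ζ).real E := by
    rw [← abs_of_pos hm0, ← abs_mul, key]
    exact herr
  have hmR : 1 ≤ R * m := by
    have := mul_le_mul_of_nonneg_left hm_pos hR0.le
    rwa [mul_inv_cancel₀ hR0.ne'] at this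
  calc |(U.spec β A (spinFlip x ζ)).real E - (U.spec β A ζ).real E|
      ≤ (R * m) * |(U.spec β A (spinFlip x ζ)).real E - (U.spec β A ζ).real E| :=
        le_mul_of_one_le_left (abs_nonneg _) hmR
    _ = R * (|(U.spec β A (spinFlip x ζ)).real E - (U.spec β A ζ).real E| * m) := by ring
    _ ≤ R * (δ * (U.spec β A ζ).real E) := mul_le_mul_of_nonneg_left habs hR0.le
    _ = (R * δ) * (U.spec β A ζ).real E := by ring

/-- **[Mar99] Proposition 2.12, (2.28)**: telescoping the boundary flips multiplicatively.  If every single flip at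
a site of `S` changes `μ_A^{(·)}(E)` by at most the factor `1 + a` (in the sense
`|μ_A^{ζ^y}(E) − μ_A^ζ(E)| ≤ a μ_A^ζ(E)` for all `ζ`), and `η, η'` agree except on sites of `S` and on sites read
neither by the energy of `A` nor by `E`, then `|μ_A^{η'}(E) − μ_A^η(E)| ≤ ((1+a)^{|S|} − 1) μ_A^η(E)`.
[cite: Martinelli1999, Proposition 2.12] -/
theorem abs_spec_real_sub_le_pow_mul_real (A : Finset (Site d)) {E : Set (Site d → ℤˣ)} (hE : MeasurableSet E)
    {T : Set (Site d)} (hET : DependsOn (· ∈ E) T) (S : Finset (Site d)) {a : ℝ} (ha : 0 ≤ a)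
    (hstep : ∀ (ζ : Site d → ℤˣ), ∀ y ∈ S,
      |(U.spec β A (spinFlip y ζ)).real E - (U.spec β A ζ).real E| ≤ a * (U.spec β A ζ).real E)
    (η η' : Site d → ℤˣ) (hS : ∀ y ∈ rOuterBoundary r A, η y ≠ η' y → y ∈ S)
    (hTagree : ∀ z ∈ T, z ∉ A → η z = η' z) :
    |(U.spec β A η').real E - (U.spec β A η).real E| ≤ ((1 + a) ^ S.card - 1) * (U.spec β A η).real E := by
  classical
  set W := rOuterBoundary r A with hW
  -- Markov reduction: only the spins on `W ∩ S` matter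
  set η'' := (W ∩ S).piecewise η' η with hη''
  have hred : (U.spec β A η').real E = (U.spec β A η'').real E := by
    refine U.spec_real_eq_of_agree β A hE hET (fun z hz hzA => ?_) (fun z hz => ?_)
    · by_cases hzs : z ∈ W ∩ S
      · rw [hη'', Finset.piecewise_eq_of_mem _ _ _ hzs]
      · rw [hη'', Finset.piecewise_eq_of_notMem _ _ _ hzs]
        exact (hTagree z hz hzA).symm
    · by_cases hzs : z ∈ W ∩ S
      · rw [hη'', Finset.piecewise_eq_of_mem _ _ _ hzs]
      · rw [hη'', Finset.piecewise_eq_of_notMem _ _ _ hzs]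
        by_contra hne
        exact hzs (Finset.mem_inter.2 ⟨hz, hS z hz (Ne.symm hne)⟩)
  -- two-sided multiplicative step
  have hstep2 : ∀ (ζ : Site d → ℤˣ), ∀ y ∈ S, ∀ s : ℤˣ,
      (U.spec β A (Function.update ζ y s)).real E ≤ (1 + a) * (U.spec β A ζ).real E ∧
        (U.spec β A ζ).real E ≤ (1 + a) * (U.spec β A (Function.update ζ y s)).real E := by
    intro ζ y hy s
    by_cases hs : s = ζ y
    · rw [hs, Function.update_eq_self]
      constructor <;> nlinarith [measureReal_nonneg (μ := U.spec β A ζ) (s := E)]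
    · have hflip : Function.update ζ y s = spinFlip y ζ := by
        funext z
        rw [Function.update_apply, spinFlip_apply]
        split_ifs with hz
        · exact Int.units_ne_iff_eq_neg.1 hs
        · rfl
      rw [hflip]
      have h1 := hstep ζ y hy
      have h2 := hstep (spinFlip y ζ) y hy
      rw [spinFlip_spinFlip] at h2
      rw [abs_le] at h1 h2
      constructor <;> linarith
  -- induction over the switched sites
  have hind : ∀ S' : Finset (Site d), S' ⊆ W ∩ S →
      (U.spec β A (S'.piecewise η' η)).real E ≤ (1 + a) ^ S'.card * (U.spec β A η).real E ∧
        (U.spec β A η).real E ≤ (1 + a) ^ S'.card * (U.spec β A (S'.piecewise η' η)).real E := by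
    intro S'
    induction S' using Finset.induction_on with
    | empty =>
      intro _
      simp
    | insert y S' hyS' ih =>
      intro hsub
      have hy : y ∈ S := (Finset.mem_inter.1 (hsub (Finset.mem_insert_self y S'))).2
      have hsub' : S' ⊆ W ∩ S := fun z hz => hsub (Finset.mem_insert_of_mem hz)
      obtain ⟨ih1, ih2⟩ := ih hsub'
      rw [Finset.piecewise_insert, Finset.card_insert_of_notMem hyS', pow_succ]
      obtain ⟨h1, h2⟩ := hstep2 (S'.piecewise η' η) y hy (η' y)
      have h1a : 0 ≤ 1 + a := by linarith
      constructor
      · calc (U.spec β A (Function.update (S'.piecewise η' η) y (η' y))).real E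
            ≤ (1 + a) * (U.spec β A (S'.piecewise η' η)).real E := h1
          _ ≤ (1 + a) * ((1 + a) ^ S'.card * (U.spec β A η).real E) := mul_le_mul_of_nonneg_left ih1 h1a
          _ = (1 + a) ^ S'.card * (1 + a) * (U.spec β A η).real E := by ring
      · calc (U.spec β A η).real E ≤ (1 + a) ^ S'.card * (U.spec β A (S'.piecewise η' η)).real E := ih2
          _ ≤ (1 + a) ^ S'.card * ((1 + a) * (U.spec β A (Function.update (S'.piecewise η' η) y (η' y))).real E) :=
              mul_le_mul_of_nonneg_left h2 (pow_nonneg h1a _)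
          _ = (1 + a) ^ S'.card * (1 + a) *
                (U.spec β A (Function.update (S'.piecewise η' η) y (η' y))).real E := by ring
  obtain ⟨hup, hdown⟩ := hind (W ∩ S) Finset.Subset.rfl
  rw [hred]
  set q := (1 + a) ^ (W ∩ S).card with hq
  set Q := (1 + a) ^ S.card with hQ
  have hq1 : 1 ≤ q := one_le_pow₀ (by linarith)
  have hqQ : q ≤ Q := pow_le_pow_right₀ (by linarith) (Finset.card_le_card Finset.inter_subset_right)
  set u := (U.spec β A η'').real E
  set v := (U.spec β A η).real E
  have hv0 : 0 ≤ v := measureReal_nonneg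
  have hq0 : 0 < q := by linarith
  rw [abs_le]
  constructor
  · -- `v − u ≤ (Q − 1) v`, from `v ≤ q u`
    have hA : q * (v - u) ≤ (q - 1) * v := by linarith [hdown]
    have hB : (q - 1) * v ≤ q * ((q - 1) * v) := by
      have : 0 ≤ (q - 1) * v := mul_nonneg (by linarith) hv0
      nlinarith
    have hC : v - u ≤ (q - 1) * v := le_of_mul_le_mul_left (hA.trans hB) hq0
    have hC' : v - u ≤ (Q - 1) * v := hC.trans (mul_le_mul_of_nonneg_right (by linarith) hv0)
    linarith
  · have hA : q * v ≤ Q * v := mul_le_mul_of_nonneg_right hqQ hv0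
    linarith [hup]

/-- **[Mar99] Proposition 2.12 in the two-block form (3.33)**: for `V = A ∪ B` and an event `E` reading, inside
`A`, only sites at distance `> r`… (abstractly: an event for which every single flip at a site of
`∂_r^+A ∩ B` costs at most the factor `1 + a`), `|μ_A^τ(E) − μ_V^τ(E)| ≤ κ/(1−κ) · μ_V^τ(E)` with
`κ = (1+a)^{|∂_r^+A ∩ B|} − 1 < 1` (DLR: `μ_V^τ(E) = μ_V^τ(μ_A(E))`, and `μ_A^σ(E)` is within the factor
`1 ± κ` of `μ_A^τ(E)` for `σ = τ` off `V`). [cite: Martinelli1999, Proposition 2.12] -/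
theorem abs_spec_real_sub_union_le_mul_real {A B : Finset (Site d)} {E : Set (Site d → ℤˣ)}
    (hE : MeasurableSet E) {T : Set (Site d)} (hET : DependsOn (· ∈ E) T) (hTB : ∀ z ∈ T, z ∈ B → z ∈ A)
    {a : ℝ} (ha : 0 ≤ a)
    (hstep : ∀ (ζ : Site d → ℤˣ), ∀ y ∈ (rOuterBoundary r A).filter (· ∈ B),
      |(U.spec β A (spinFlip y ζ)).real E - (U.spec β A ζ).real E| ≤ a * (U.spec β A ζ).real E)
    (hκ : (1 + a) ^ ((rOuterBoundary r A).filter (· ∈ B)).card - 1 < 1) (τ : Site d → ℤˣ) :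
    |(U.spec β A τ).real E - (U.spec β (A ∪ B) τ).real E| ≤
      (((1 + a) ^ ((rOuterBoundary r A).filter (· ∈ B)).card - 1) /
        (1 - ((1 + a) ^ ((rOuterBoundary r A).filter (· ∈ B)).card - 1))) * (U.spec β (A ∪ B) τ).real E := by
  classical
  have hγ := U.isSpecification_spec β
  haveI := hγ.isProbability (A ∪ B) τ
  haveI := hγ.isProbability A τ
  set S := (rOuterBoundary r A).filter (· ∈ B) with hS
  set κ := (1 + a) ^ S.card - 1 with hκdef
  have hκ0 : 0 ≤ κ := by
    have := one_le_pow₀ (n := S.card) (show (1 : ℝ) ≤ 1 + a by linarith)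
    linarith
  -- DLR: `μ_V^τ(E) = ∫ μ_A^σ(E) dμ_V^τ(σ)`
  set F : (Site d → ℤˣ) → ℝ := E.indicator 1 with hF
  have hFm : Measurable F := measurable_one.indicator hE
  have hFb : ∀ σ, |F σ| ≤ 1 := fun σ => by
    rw [hF]
    by_cases hσ : σ ∈ E
    · rw [Set.indicator_of_mem hσ]; simp
    · rw [Set.indicator_of_notMem hσ]; simp
  have hAV : A ⊆ A ∪ B := Finset.subset_union_left
  have hDLR : (U.spec β (A ∪ B) τ).real E = ∫ σ, (U.spec β A σ).real E ∂(U.spec β (A ∪ B) τ) := by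
    rw [← integral_indicator_one hE, ← integral_integral_spec hγ hAV τ hFm hFb]
    refine integral_congr_ae (Eventually.of_forall fun σ => ?_)
    exact integral_indicator_one hE
  -- for `σ = τ` off `V`, `μ_A^σ(E)` is within the factor of `μ_A^τ(E)`
  have hpoint : ∀ σ : Site d → ℤˣ, (∀ z ∉ A ∪ B, σ z = τ z) →
      |(U.spec β A σ).real E - (U.spec β A τ).real E| ≤ κ * (U.spec β A τ).real E := by
    intro σ hσ
    refine abs_spec_real_sub_le_pow_mul_real U β A hE hET S ha (fun ζ y hy => hstep ζ y hy) τ σ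
      (fun y hy hne => Finset.mem_filter.2 ⟨hy, ?_⟩) (fun z hz hzA => ?_)
    · by_contra hyB
      have hyA : y ∉ A := (mem_rOuterBoundary.1 hy).1
      exact hne (hσ y (by rw [Finset.mem_union]; tauto)).symm
    · by_cases hzB : z ∈ B
      · exact (hzA (hTB z hz hzB)).elim
      · exact (hσ z (by rw [Finset.mem_union]; tauto)).symm
  have hmeas : Measurable fun σ => (U.spec β A σ).real E := by
    have := measurable_bavg hγ A hFm
    have e : bavg (U.spec β) A F = fun σ => (U.spec β A σ).real E := funext fun σ => integral_indicator_one hE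
    rwa [e] at this
  have hint : Integrable (fun σ => (U.spec β A σ).real E) (U.spec β (A ∪ B) τ) :=
    Integrable.of_bound hmeas.aestronglyMeasurable 1 (Eventually.of_forall fun σ => by
      haveI := hγ.isProbability A σ
      rw [Real.norm_eq_abs, abs_of_nonneg measureReal_nonneg]; exact measureReal_le_one)
  have hdiff : |(U.spec β (A ∪ B) τ).real E - (U.spec β A τ).real E| ≤ κ * (U.spec β A τ).real E := by
    rw [hDLR]
    have e : (∫ σ, (U.spec β A σ).real E ∂(U.spec β (A ∪ B) τ)) - (U.spec β A τ).real E =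
        ∫ σ, ((U.spec β A σ).real E - (U.spec β A τ).real E) ∂(U.spec β (A ∪ B) τ) := by
      rw [integral_sub hint (integrable_const _), integral_const, smul_eq_mul, probReal_univ, one_mul]
    rw [e]
    have hb : ∀ᵐ σ ∂(U.spec β (A ∪ B) τ), ‖(U.spec β A σ).real E - (U.spec β A τ).real E‖ ≤
        κ * (U.spec β A τ).real E := by
      filter_upwards [hγ.proper (A ∪ B) τ] with σ hσ
      rw [Real.norm_eq_abs]
      exact hpoint σ hσ
    have h := norm_integral_le_of_norm_le_const hb
    rwa [probReal_univ, mul_one, Real.norm_eq_abs] at h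
  -- convert to a bound relative to `μ_V^τ(E)`
  set u := (U.spec β A τ).real E
  set w := (U.spec β (A ∪ B) τ).real E
  have hu0 : 0 ≤ u := measureReal_nonneg
  have hw0 : 0 ≤ w := measureReal_nonneg
  rw [abs_le] at hdiff
  have hκ1 : 0 < 1 - κ := by linarith
  have hu : u ≤ w / (1 - κ) := by rw [le_div_iff₀ hκ1]; nlinarith
  have hκu : κ * u ≤ κ / (1 - κ) * w := by
    calc κ * u ≤ κ * (w / (1 - κ)) := mul_le_mul_of_nonneg_left hu hκ0
      _ = κ / (1 - κ) * w := by ring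
  rw [abs_le]
  constructor
  · linarith [hdiff.2]
  · linarith [hdiff.1]

/-- **The covariance input from `SMT`** ([Mar99] Prop 2.12, hypothesis (ii) `SMT(A ∖ A₀, d₀ − 2r, m)`): under
`SMT(A ∖ A₀, l, m)`, for `x` with `d(x, A₀) ≥ d₀`, `l + 2r ≤ d₀`, every site `y ∈ ∂_r^+(A∖A₀) ∩ A ⊆ A₀`
satisfies `|μ_{A∖A₀}^ξ(h_x; h_y)| ≤ (2r+1)^{2d} R² e^{−m(d₀ − 2r)}`, hence (one flip)
`|μ_A^{ζ^x}(E) − μ_A^ζ(E)| ≤ R⁴ (2r+1)^{2d} |∂_r^+(A∖A₀) ∩ A| e^{−m(d₀−2r)} μ_A^ζ(E)`.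
[cite: Martinelli1999, Proposition 2.12] -/
theorem abs_spec_real_spinFlip_sub_le_mul_real_of_SMT {R : ℝ} (hR1 : 1 ≤ R)
    (hR : ∀ (Λ : Finset (Site d)) (y : Site d) (σ : Site d → ℤˣ),
      R⁻¹ ≤ flipWeight U β Λ y σ ∧ flipWeight U β Λ y σ ≤ R)
    {A A₀ : Finset (Site d)} {x : Site d} (hxA : x ∉ A) {d₀ : ℕ} (hd₀ : ∀ z ∈ A₀, d₀ ≤ supDist z x)
    (hrd₀ : r < d₀) {E : Set (Site d → ℤˣ)} (hE : MeasurableSet E) {T : Set (Site d)} (hET : DependsOn (· ∈ E) T)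
    (hT : ∀ z ∈ T, z ∈ A → z ∈ A₀) (hxT : x ∉ T) {l m : ℝ} (hm : 0 ≤ m) (hl : l ≤ (d₀ : ℝ) - 2 * r)
    (hSMT : SMT (U.spec β) (A \ A₀) l m) (ζ : Site d → ℤˣ) :
    |(U.spec β A (spinFlip x ζ)).real E - (U.spec β A ζ).real E| ≤
      (R ^ 4 * (2 * r + 1 : ℝ) ^ d * (2 * r + 1 : ℝ) ^ d * ((rOuterBoundary r (A \ A₀)).filter (· ∈ A)).card *
        Real.exp (-(m * ((d₀ : ℝ) - 2 * r)))) * (U.spec β A ζ).real E := by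
  classical
  have hR0 : 0 < R := by linarith
  have hvB : ∀ (Λ : Finset (Site d)) (y : Site d) (σ : Site d → ℤˣ), |flipWeight U β Λ y σ| ≤ R :=
    fun Λ y σ => by rw [abs_of_pos (flipWeight_pos U β Λ y σ)]; exact (hR Λ y σ).2
  have hxA₀ : ∀ z ∈ A₀, r < supDist z x := fun z hz => lt_of_lt_of_le hrd₀ (hd₀ z hz)
  set cst : ℝ := (2 * r + 1 : ℝ) ^ d * (2 * r + 1 : ℝ) ^ d * R * R * Real.exp (-(m * ((d₀ : ℝ) - 2 * r)))
    with hcst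
  have hc : ∀ y ∈ (rOuterBoundary r (A \ A₀)).filter (· ∈ A), ∀ ξ : Site d → ℤˣ,
      |∫ ω, flipWeight U β A x ω * flipWeight U β (A \ A₀) y ω ∂(U.spec β (A \ A₀) ξ) -
        (∫ ω, flipWeight U β A x ω ∂(U.spec β (A \ A₀) ξ)) *
          ∫ ω, flipWeight U β (A \ A₀) y ω ∂(U.spec β (A \ A₀) ξ)| ≤ cst := by
    intro y hy ξ
    obtain ⟨hyB, hyA⟩ := Finset.mem_filter.1 hy
    have hyA₀ : y ∈ A₀ := by
      have h1 : y ∉ A \ A₀ := (mem_rOuterBoundary.1 hyB).1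
      rw [Finset.mem_sdiff, not_and, not_not] at h1
      exact h1 hyA
    have hdist : l ≤ (finsetSupDist (rNeighbourhood r x) (rNeighbourhood r y) : ℝ) := by
      have h1 := supDist_le_finsetSupDist_rNeighbourhood_add (r := r) x y
      have h2 := hd₀ y hyA₀
      rw [supDist_comm y x] at h2
      have h3 : d₀ ≤ finsetSupDist (rNeighbourhood r x) (rNeighbourhood r y) + 2 * r := by omega
      have h4 : (d₀ : ℝ) ≤ (finsetSupDist (rNeighbourhood r x) (rNeighbourhood r y) : ℝ) + 2 * r := by
        exact_mod_cast h3
      linarith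
    refine (hSMT (flipWeight U β A x) (flipWeight U β (A \ A₀) y) (rNeighbourhood r x) (rNeighbourhood r y) R R
      (measurable_flipWeight U β A x) (measurable_flipWeight U β _ y) (dependsOn_flipWeight U β A x)
      (dependsOn_flipWeight U β _ y) (hvB A x) (hvB _ y) hdist ξ).trans ?_
    rw [card_rNeighbourhood, card_rNeighbourhood, hcst]
    push_cast
    have h5 : (d₀ : ℝ) - 2 * r ≤ (finsetSupDist (rNeighbourhood r x) (rNeighbourhood r y) : ℝ) := by
      have h1 := supDist_le_finsetSupDist_rNeighbourhood_add (r := r) x y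
      have h2 := hd₀ y hyA₀
      rw [supDist_comm y x] at h2
      have h3 : d₀ ≤ finsetSupDist (rNeighbourhood r x) (rNeighbourhood r y) + 2 * r := by omega
      have h4 : (d₀ : ℝ) ≤ (finsetSupDist (rNeighbourhood r x) (rNeighbourhood r y) : ℝ) + 2 * r := by
        exact_mod_cast h3
      linarith
    have hexp' : Real.exp (-(m * (finsetSupDist (rNeighbourhood r x) (rNeighbourhood r y) : ℝ))) ≤
        Real.exp (-(m * ((d₀ : ℝ) - 2 * r))) :=
      Real.exp_le_exp.2 (neg_le_neg (mul_le_mul_of_nonneg_left h5 hm))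
    gcongr
  refine (abs_spec_real_spinFlip_sub_le_mul_real U β hR1 hR hxA hxA₀ hE hET hT hxT hc ζ).trans ?_
  rw [Finset.sum_const, nsmul_eq_mul, hcst]
  refine mul_le_mul_of_nonneg_right (le_of_eq ?_) measureReal_nonneg
  ring

/-! ### One conditioning step: covariances in `W` from covariances in a sub-volume `A ⊆ W`

For the application of Proposition 2.12 / (3.33) in [Mar99] Theorem 4.5 the `SMT` hypothesis is available only on
a restricted class of volumes (fat rectangles), while the covariances are needed in other volumes (`A ∖ A₀` = a
thin strip).  The following one-step form of (2.25) (with `C = ∅`) moves the covariance into ANY sub-volume `A ⊆ W`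
containing the `W`-part of the support of `u` and avoiding the support of `v`:
`μ_W^ξ(u; v) = μ_W^ξ((μ_A(u) − μ_W^ξ(u)) · v)` and `‖μ_A(u) − μ_W^ξ(u)‖ ≤ R Σ_{z∈∂_r^+A∩W} sup_ζ |μ_A^ζ(u; h_z^A)|`
by (2.18). -/

/-- **One conditioning step** ([Mar99] (2.25) with `C = ∅`, and (2.18)): for `A ⊆ W`, `u` reading inside `W`
only sites of `A`, and `v` reading no site of `A`,
`|μ_W^ξ(u; v)| ≤ ‖v‖ · R Σ_{z ∈ ∂_r^+A ∩ W} c_z`, where `c_z ≥ sup_ζ |μ_A^ζ(u; h_z^A)|`.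
[cite: Martinelli1999, Lemma 2.10, proof, (2.25)] -/
theorem abs_cov_le_of_subvolume {R : ℝ} (hR1 : 1 ≤ R)
    (hR : ∀ (Λ : Finset (Site d)) (y : Site d) (σ : Site d → ℤˣ),
      R⁻¹ ≤ flipWeight U β Λ y σ ∧ flipWeight U β Λ y σ ≤ R)
    {W A : Finset (Site d)} (hAW : A ⊆ W) {u v : (Site d → ℤˣ) → ℝ} (hum : Measurable u) (hvm : Measurable v)
    {Tu Tv : Set (Site d)} (hu : DependsOn u Tu) (hv : DependsOn v Tv) (hTu : ∀ z ∈ Tu, z ∈ W → z ∈ A)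
    (hTv : ∀ z ∈ Tv, z ∉ A) {Bu Bv : ℝ} (hBu : ∀ σ, |u σ| ≤ Bu) (hBv : ∀ σ, |v σ| ≤ Bv) {c : Site d → ℝ}
    (hc : ∀ z ∈ (rOuterBoundary r A).filter (· ∈ W), ∀ ζ : Site d → ℤˣ,
      |∫ ω, u ω * flipWeight U β A z ω ∂(U.spec β A ζ) -
        (∫ ω, u ω ∂(U.spec β A ζ)) * ∫ ω, flipWeight U β A z ω ∂(U.spec β A ζ)| ≤ c z)
    (ξ : Site d → ℤˣ) :
    |∫ σ, u σ * v σ ∂(U.spec β W ξ) - (∫ σ, u σ ∂(U.spec β W ξ)) * ∫ σ, v σ ∂(U.spec β W ξ)| ≤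
      Bv * (R * ∑ z ∈ (rOuterBoundary r A).filter (· ∈ W), c z) := by
  classical
  have hγ := U.isSpecification_spec β
  haveI := hγ.isProbability W ξ
  have hBu0 : 0 ≤ Bu := (abs_nonneg _).trans (hBu ξ)
  have hBv0 : 0 ≤ Bv := (abs_nonneg _).trans (hBv ξ)
  set Φ := bavg (U.spec β) A u with hΦ
  have hΦm : Measurable Φ := measurable_bavg hγ A hum
  have hΦB : ∀ σ, |Φ σ| ≤ Bu := abs_bavg_le hγ A hBu
  -- DLR with pull-out of `v`
  have e1 : ∫ σ, u σ * v σ ∂(U.spec β W ξ) = ∫ σ, v σ * Φ σ ∂(U.spec β W ξ) := by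
    have hb : ∀ σ, |v σ * u σ| ≤ Bv * Bu := fun σ => by
      rw [abs_mul]; exact mul_le_mul (hBv σ) (hBu σ) (abs_nonneg _) hBv0
    have h := integral_integral_spec hγ hAW ξ (h := fun σ => v σ * u σ) (hvm.mul hum) hb
    rw [show (fun σ => u σ * v σ) = fun σ => v σ * u σ from funext fun σ => mul_comm _ _, ← h]
    exact integral_congr_ae (Eventually.of_forall fun σ => bavg_mul_of_dependsOn hγ A hv hTv u σ)
  -- oscillation of `Φ`
  have hosc : ∀ σ σ' : Site d → ℤˣ, (∀ z ∉ W, σ z = σ' z) →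
      |Φ σ - Φ σ'| ≤ R * ∑ z ∈ (rOuterBoundary r A).filter (· ∈ W), c z := fun σ σ' hagree =>
    abs_bavg_sub_bavg_le_sum U β hR1 hR (W := W) (A := A) hum hu hTu hc σ σ' hagree
  have hae := abs_bavg_sub_integral_le_ae U β hAW ξ hum hBu hosc
  set cu := ∫ σ, u σ ∂(U.spec β W ξ) with hcu
  have hiv : Integrable v (U.spec β W ξ) := Integrable.of_bound hvm.aestronglyMeasurable Bv
    (Eventually.of_forall fun σ => by rw [Real.norm_eq_abs]; exact hBv σ)
  have hivΦ : Integrable (fun σ => v σ * Φ σ) (U.spec β W ξ) :=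
    Integrable.of_bound (hvm.mul hΦm).aestronglyMeasurable (Bv * Bu) (Eventually.of_forall fun σ => by
      rw [Real.norm_eq_abs, abs_mul]; exact mul_le_mul (hBv σ) (hΦB σ) (abs_nonneg _) hBv0)
  have e2 : ∫ σ, v σ * Φ σ ∂(U.spec β W ξ) - cu * ∫ σ, v σ ∂(U.spec β W ξ) =
      ∫ σ, v σ * (Φ σ - cu) ∂(U.spec β W ξ) := by
    rw [← integral_const_mul, ← integral_sub hivΦ (hiv.const_mul cu)]
    exact integral_congr_ae (Eventually.of_forall fun σ => by ring)
  rw [e1, e2]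
  have hb : ∀ᵐ σ ∂(U.spec β W ξ), ‖v σ * (Φ σ - cu)‖ ≤
      Bv * (R * ∑ z ∈ (rOuterBoundary r A).filter (· ∈ W), c z) := by
    filter_upwards [hae] with σ hσ
    rw [Real.norm_eq_abs, abs_mul]
    exact mul_le_mul (hBv σ) hσ (abs_nonneg _) hBv0
  have h := norm_integral_le_of_norm_le_const hb
  rwa [probReal_univ, mul_one, Real.norm_eq_abs] at h

/-- **One conditioning step with `SMT` in the sub-volume**: if `SMT(A, l, m)` holds for some `A ⊆ W` with
`N_r(x) ∩ W ⊆ A`, `N_r(y) ∩ A = ∅`, and every site of `∂_r^+A ∩ W` is at distance `≥ ρ` from `x` with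
`l + 2r ≤ ρ`, then for `u` reading `N_r(x)` and `v` reading `N_r(y)`,
`|μ_W^ξ(u; v)| ≤ ‖u‖‖v‖ R² (2r+1)^{2d} |∂_r^+A ∩ W| e^{−m(ρ − 2r)}`.  (The form in which the fat-rectangle `SMT`
hypothesis of [Mar99] Theorem 4.5 feeds Proposition 2.12 inside a thin strip: take for `A` a fat box around `x`.)
[cite: Martinelli1999, Lemma 2.10, proof, (2.25)] -/
theorem abs_cov_le_of_SMT_subvolume {R : ℝ} (hR1 : 1 ≤ R)
    (hR : ∀ (Λ : Finset (Site d)) (y : Site d) (σ : Site d → ℤˣ),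
      R⁻¹ ≤ flipWeight U β Λ y σ ∧ flipWeight U β Λ y σ ≤ R)
    {W A : Finset (Site d)} (hAW : A ⊆ W) {x y : Site d}
    (hxA : ∀ z ∈ rNeighbourhood r x, z ∈ W → z ∈ A) (hyA : ∀ z ∈ rNeighbourhood r y, z ∉ A)
    {ρ : ℕ} (hρ : ∀ z ∈ (rOuterBoundary r A).filter (· ∈ W), ρ ≤ supDist z x)
    {u v : (Site d → ℤˣ) → ℝ} (hum : Measurable u) (hvm : Measurable v)
    (hu : DependsOn u (↑(rNeighbourhood r x) : Set (Site d))) (hv : DependsOn v (↑(rNeighbourhood r y) : Set (Site d)))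
    {Bu Bv : ℝ} (hBu : ∀ σ, |u σ| ≤ Bu) (hBv : ∀ σ, |v σ| ≤ Bv) {l m : ℝ} (hm : 0 ≤ m)
    (hl : l ≤ (ρ : ℝ) - 2 * r) (hSMT : SMT (U.spec β) A l m) (ξ : Site d → ℤˣ) :
    |∫ σ, u σ * v σ ∂(U.spec β W ξ) - (∫ σ, u σ ∂(U.spec β W ξ)) * ∫ σ, v σ ∂(U.spec β W ξ)| ≤
      Bu * Bv * R ^ 2 * (2 * r + 1 : ℝ) ^ d * (2 * r + 1 : ℝ) ^ d * ((rOuterBoundary r A).filter (· ∈ W)).card *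
        Real.exp (-(m * ((ρ : ℝ) - 2 * r))) := by
  classical
  have hR0 : 0 < R := by linarith
  have hBu0 : 0 ≤ Bu := (abs_nonneg _).trans (hBu ξ)
  have hvB : ∀ (Λ : Finset (Site d)) (z : Site d) (σ : Site d → ℤˣ), |flipWeight U β Λ z σ| ≤ R :=
    fun Λ z σ => by rw [abs_of_pos (flipWeight_pos U β Λ z σ)]; exact (hR Λ z σ).2
  set cst : ℝ := (2 * r + 1 : ℝ) ^ d * (2 * r + 1 : ℝ) ^ d * Bu * R * Real.exp (-(m * ((ρ : ℝ) - 2 * r)))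
    with hcst
  have hc : ∀ z ∈ (rOuterBoundary r A).filter (· ∈ W), ∀ ζ : Site d → ℤˣ,
      |∫ ω, u ω * flipWeight U β A z ω ∂(U.spec β A ζ) -
        (∫ ω, u ω ∂(U.spec β A ζ)) * ∫ ω, flipWeight U β A z ω ∂(U.spec β A ζ)| ≤ cst := by
    intro z hz ζ
    have h5 : (ρ : ℝ) - 2 * r ≤ (finsetSupDist (rNeighbourhood r x) (rNeighbourhood r z) : ℝ) := by
      have h1 := supDist_le_finsetSupDist_rNeighbourhood_add (r := r) x z
      have h2 := hρ z hz
      rw [supDist_comm z x] at h2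
      have h3 : ρ ≤ finsetSupDist (rNeighbourhood r x) (rNeighbourhood r z) + 2 * r := by omega
      have h4 : (ρ : ℝ) ≤ (finsetSupDist (rNeighbourhood r x) (rNeighbourhood r z) : ℝ) + 2 * r := by
        exact_mod_cast h3
      linarith
    have hdist : l ≤ (finsetSupDist (rNeighbourhood r x) (rNeighbourhood r z) : ℝ) := hl.trans h5
    refine (hSMT u (flipWeight U β A z) (rNeighbourhood r x) (rNeighbourhood r z) Bu R hum
      (measurable_flipWeight U β A z) hu (dependsOn_flipWeight U β A z) hBu (hvB A z) hdist ζ).trans ?_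
    rw [card_rNeighbourhood, card_rNeighbourhood, hcst]
    push_cast
    have hexp' : Real.exp (-(m * (finsetSupDist (rNeighbourhood r x) (rNeighbourhood r z) : ℝ))) ≤
        Real.exp (-(m * ((ρ : ℝ) - 2 * r))) :=
      Real.exp_le_exp.2 (neg_le_neg (mul_le_mul_of_nonneg_left h5 hm))
    gcongr
  have hTu : ∀ z ∈ (↑(rNeighbourhood r x) : Set (Site d)), z ∈ W → z ∈ A := fun z hz hzW =>
    hxA z (Finset.mem_coe.1 hz) hzW
  have hTv : ∀ z ∈ (↑(rNeighbourhood r y) : Set (Site d)), z ∉ A := fun z hz => hyA z (Finset.mem_coe.1 hz)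
  refine (abs_cov_le_of_subvolume U β hR1 hR hAW hum hvm hu hv hTu hTv hBu hBv hc ξ).trans ?_
  rw [Finset.sum_const, nsmul_eq_mul, hcst]
  exact le_of_eq (by ring)

/-! ### The two-block density hypothesis (3.33) from `SMT` in fat sub-boxes of the overlap -/

/-- **(3.33) from local `SMT`** — the input of [Mar99] Proposition 3.5 for two overlapping blocks `A, B`
(Theorem 4.5's `R_n^top, R_n^bot`), from `SMT` on sub-volumes of the OVERLAP `A ∩ B` only.  Assume: the flip
sites `y ∈ ∂_r^+A ∩ B` are at distance `> r` from `A ∖ B`; for each such `y` there is a sub-volume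
`A'_y ⊆ A ∩ B` with `SMT(A'_y, l, m)`, containing `N_r(y) ∩ (A ∩ B)`… more precisely `N_r(y) ∩ A ⊆ A'_y`,
avoiding `N_r(z)` for the sites `z ∈ ∂_r^+(A∩B) ∩ A`, with `|∂_r^+A'_y ∩ (A∩B)| ≤ P` and all of
`∂_r^+A'_y ∩ (A ∩ B)` at distance `≥ ρ ≥ l + 2r` from `y`.  Then with
`a = R⁶ (2r+1)^{2d} |∂_r^+(A∩B) ∩ A| P e^{−m(ρ−2r)}` and `κ = (1+a)^{|∂_r^+A ∩ B|} − 1 < 1`: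
`|μ_A^τ(E) − μ_{A∪B}^τ(E)| ≤ κ/(1−κ) μ_{A∪B}^τ(E)` for every `𝓕_{∂_r^+B}`-local event `E` and every `τ`.
[cite: Martinelli1999, Proposition 2.12; Theorem 4.5, proof, p0189 L3–7] -/
theorem abs_spec_real_sub_union_le_of_local_SMT {R : ℝ} (hR1 : 1 ≤ R)
    (hR : ∀ (Λ : Finset (Site d)) (y : Site d) (σ : Site d → ℤˣ),
      R⁻¹ ≤ flipWeight U β Λ y σ ∧ flipWeight U β Λ y σ ≤ R)
    {A B : Finset (Site d)} (hsep : ∀ y ∈ (rOuterBoundary r A).filter (· ∈ B), ∀ z ∈ A \ B, r < supDist z y)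
    {ρ P : ℕ} {l m : ℝ} (hm : 0 ≤ m) (hl : l ≤ (ρ : ℝ) - 2 * r)
    (hbox : ∀ y ∈ (rOuterBoundary r A).filter (· ∈ B), ∃ A' : Finset (Site d), A' ⊆ A ∩ B ∧
      (∀ w ∈ rNeighbourhood r y, w ∈ A ∩ B → w ∈ A') ∧
      (∀ z ∈ (rOuterBoundary r (A ∩ B)).filter (· ∈ A), ∀ w ∈ rNeighbourhood r z, w ∉ A') ∧
      (∀ w ∈ (rOuterBoundary r A').filter (· ∈ A ∩ B), ρ ≤ supDist w y) ∧
      ((rOuterBoundary r A').filter (· ∈ A ∩ B)).card ≤ P ∧ SMT (U.spec β) A' l m)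
    (hκ : (1 + R ^ 6 * (2 * r + 1 : ℝ) ^ d * (2 * r + 1 : ℝ) ^ d * ((rOuterBoundary r (A ∩ B)).filter (· ∈ A)).card *
        P * Real.exp (-(m * ((ρ : ℝ) - 2 * r)))) ^ ((rOuterBoundary r A).filter (· ∈ B)).card - 1 < 1)
    (τ : Site d → ℤˣ) {E : Set (Site d → ℤˣ)} (hE : MeasurableSet E)
    (hEB : DependsOn (· ∈ E) (↑(rOuterBoundary r B) : Set (Site d))) :
    |(U.spec β A τ).real E - (U.spec β (A ∪ B) τ).real E| ≤
      (((1 + R ^ 6 * (2 * r + 1 : ℝ) ^ d * (2 * r + 1 : ℝ) ^ d *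
          ((rOuterBoundary r (A ∩ B)).filter (· ∈ A)).card * P * Real.exp (-(m * ((ρ : ℝ) - 2 * r)))) ^
          ((rOuterBoundary r A).filter (· ∈ B)).card - 1) /
        (1 - ((1 + R ^ 6 * (2 * r + 1 : ℝ) ^ d * (2 * r + 1 : ℝ) ^ d *
          ((rOuterBoundary r (A ∩ B)).filter (· ∈ A)).card * P * Real.exp (-(m * ((ρ : ℝ) - 2 * r)))) ^
          ((rOuterBoundary r A).filter (· ∈ B)).card - 1))) * (U.spec β (A ∪ B) τ).real E := by
  classical
  have hR0 : 0 < R := by linarith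
  have hvB : ∀ (Λ : Finset (Site d)) (z : Site d) (σ : Site d → ℤˣ), |flipWeight U β Λ z σ| ≤ R :=
    fun Λ z σ => by rw [abs_of_pos (flipWeight_pos U β Λ z σ)]; exact (hR Λ z σ).2
  -- `A₀ = A ∖ B`, `A ∖ A₀ = A ∩ B`
  have hsd : A \ (A \ B) = A ∩ B := by
    ext z; simp only [Finset.mem_sdiff, Finset.mem_inter, not_and, not_not]; tauto
  set S := (rOuterBoundary r (A ∩ B)).filter (· ∈ A) with hS
  set a : ℝ := R ^ 6 * (2 * r + 1 : ℝ) ^ d * (2 * r + 1 : ℝ) ^ d * S.card * P *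
    Real.exp (-(m * ((ρ : ℝ) - 2 * r))) with ha
  have ha0 : 0 ≤ a := by positivity
  -- the single-flip bound
  have hstep : ∀ (ζ : Site d → ℤˣ), ∀ y ∈ (rOuterBoundary r A).filter (· ∈ B),
      |(U.spec β A (spinFlip y ζ)).real E - (U.spec β A ζ).real E| ≤ a * (U.spec β A ζ).real E := by
    intro ζ y hy
    obtain ⟨hyBd, hyB⟩ := Finset.mem_filter.1 hy
    have hyA : y ∉ A := (mem_rOuterBoundary.1 hyBd).1
    obtain ⟨A', hA'O, hNy, hNz, hρy, hP, hSMT⟩ := hbox y hy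
    have hA'A : A' ⊆ A := hA'O.trans Finset.inter_subset_left
    -- the covariance constants in `A ∩ B`
    set cst : ℝ := R * R * R ^ 2 * (2 * r + 1 : ℝ) ^ d * (2 * r + 1 : ℝ) ^ d * P *
      Real.exp (-(m * ((ρ : ℝ) - 2 * r))) with hcst
    have hc : ∀ z ∈ (rOuterBoundary r (A \ (A \ B))).filter (· ∈ A), ∀ ξ : Site d → ℤˣ,
        |∫ ω, flipWeight U β A y ω * flipWeight U β (A \ (A \ B)) z ω ∂(U.spec β (A \ (A \ B)) ξ) -
          (∫ ω, flipWeight U β A y ω ∂(U.spec β (A \ (A \ B)) ξ)) *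
            ∫ ω, flipWeight U β (A \ (A \ B)) z ω ∂(U.spec β (A \ (A \ B)) ξ)| ≤ cst := by
      rw [hsd]
      intro z hz ξ
      have h := abs_cov_le_of_SMT_subvolume U β hR1 hR (W := A ∩ B) (A := A') hA'O (x := y) (y := z)
        (fun w hw hwO => hNy w hw hwO) (fun w hw => hNz z hz w hw) (ρ := ρ) (fun w hw => hρy w hw)
        (measurable_flipWeight U β A y) (measurable_flipWeight U β (A ∩ B) z)
        (dependsOn_flipWeight U β A y) (dependsOn_flipWeight U β (A ∩ B) z) (hvB A y) (hvB _ z) hm hl hSMT ξ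
      refine h.trans ?_
      rw [hcst]
      have hPc : (((rOuterBoundary r A').filter (· ∈ A ∩ B)).card : ℝ) ≤ P := by exact_mod_cast hP
      gcongr
    have hxA₀ : ∀ z ∈ A \ B, r < supDist z y := fun z hz => hsep y hy z hz
    have hT : ∀ z ∈ (↑(rOuterBoundary r B) : Set (Site d)), z ∈ A → z ∈ A \ B := by
      intro z hz hzA
      have hzB : z ∉ B := (mem_rOuterBoundary.1 (Finset.mem_coe.1 hz)).1
      exact Finset.mem_sdiff.2 ⟨hzA, hzB⟩
    have hyT : y ∉ (↑(rOuterBoundary r B) : Set (Site d)) := fun h =>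
      (mem_rOuterBoundary.1 (Finset.mem_coe.1 h)).1 hyB
    have h := abs_spec_real_spinFlip_sub_le_mul_real U β hR1 hR (A := A) (A₀ := A \ B) hyA hxA₀ hE hEB hT hyT
      hc ζ
    refine h.trans (mul_le_mul_of_nonneg_right ?_ measureReal_nonneg)
    rw [Finset.sum_const, nsmul_eq_mul, hsd, ha, hcst]
    exact le_of_eq (by ring)
  have hTB : ∀ z ∈ (↑(rOuterBoundary r B) : Set (Site d)), z ∈ B → z ∈ A := fun z hz hzB =>
    ((mem_rOuterBoundary.1 (Finset.mem_coe.1 hz)).1 hzB).elim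
  exact abs_spec_real_sub_union_le_mul_real U β hE hEB hTB ha0 hstep hκ τ

/-- **(3.33) from local `SMT`, for events reading no spin of `B`** — the marginal of `μ_A^τ` versus
`μ_{A∪B}^τ` on `𝓕_{(A ∪ B) ∖ B}`-local events (support `T` with `T ∩ B = ∅`), from `SMT` on sub-boxes of the
overlap only; same proof as `abs_spec_real_sub_union_le_of_local_SMT`.  This is the form needed in [Mar99]
Theorem 4.6, (4.21) (there combined with Proposition 3.11).
[cite: Martinelli1999, Proposition 2.12; Theorem 4.6, proof, (4.21) p0190] -/
theorem abs_spec_real_sub_union_le_of_local_SMT' {R : ℝ} (hR1 : 1 ≤ R)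
    (hR : ∀ (Λ : Finset (Site d)) (y : Site d) (σ : Site d → ℤˣ),
      R⁻¹ ≤ flipWeight U β Λ y σ ∧ flipWeight U β Λ y σ ≤ R)
    {A B : Finset (Site d)} (hsep : ∀ y ∈ (rOuterBoundary r A).filter (· ∈ B), ∀ z ∈ A \ B, r < supDist z y)
    {ρ P : ℕ} {l m : ℝ} (hm : 0 ≤ m) (hl : l ≤ (ρ : ℝ) - 2 * r)
    (hbox : ∀ y ∈ (rOuterBoundary r A).filter (· ∈ B), ∃ A' : Finset (Site d), A' ⊆ A ∩ B ∧
      (∀ w ∈ rNeighbourhood r y, w ∈ A ∩ B → w ∈ A') ∧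
      (∀ z ∈ (rOuterBoundary r (A ∩ B)).filter (· ∈ A), ∀ w ∈ rNeighbourhood r z, w ∉ A') ∧
      (∀ w ∈ (rOuterBoundary r A').filter (· ∈ A ∩ B), ρ ≤ supDist w y) ∧
      ((rOuterBoundary r A').filter (· ∈ A ∩ B)).card ≤ P ∧ SMT (U.spec β) A' l m)
    (hκ : (1 + R ^ 6 * (2 * r + 1 : ℝ) ^ d * (2 * r + 1 : ℝ) ^ d * ((rOuterBoundary r (A ∩ B)).filter (· ∈ A)).card *
        P * Real.exp (-(m * ((ρ : ℝ) - 2 * r)))) ^ ((rOuterBoundary r A).filter (· ∈ B)).card - 1 < 1)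
    (τ : Site d → ℤˣ) {E : Set (Site d → ℤˣ)} (hE : MeasurableSet E) {T : Set (Site d)}
    (hET : DependsOn (· ∈ E) T) (hTB : ∀ z ∈ T, z ∉ B) :
    |(U.spec β A τ).real E - (U.spec β (A ∪ B) τ).real E| ≤
      (((1 + R ^ 6 * (2 * r + 1 : ℝ) ^ d * (2 * r + 1 : ℝ) ^ d *
          ((rOuterBoundary r (A ∩ B)).filter (· ∈ A)).card * P * Real.exp (-(m * ((ρ : ℝ) - 2 * r)))) ^
          ((rOuterBoundary r A).filter (· ∈ B)).card - 1) /
        (1 - ((1 + R ^ 6 * (2 * r + 1 : ℝ) ^ d * (2 * r + 1 : ℝ) ^ d *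
          ((rOuterBoundary r (A ∩ B)).filter (· ∈ A)).card * P * Real.exp (-(m * ((ρ : ℝ) - 2 * r)))) ^
          ((rOuterBoundary r A).filter (· ∈ B)).card - 1))) * (U.spec β (A ∪ B) τ).real E := by
  classical
  have hR0 : 0 < R := by linarith
  have hvB : ∀ (Λ : Finset (Site d)) (z : Site d) (σ : Site d → ℤˣ), |flipWeight U β Λ z σ| ≤ R :=
    fun Λ z σ => by rw [abs_of_pos (flipWeight_pos U β Λ z σ)]; exact (hR Λ z σ).2
  -- `A₀ = A ∖ B`, `A ∖ A₀ = A ∩ B`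
  have hsd : A \ (A \ B) = A ∩ B := by
    ext z; simp only [Finset.mem_sdiff, Finset.mem_inter, not_and, not_not]; tauto
  set S := (rOuterBoundary r (A ∩ B)).filter (· ∈ A) with hS
  set a : ℝ := R ^ 6 * (2 * r + 1 : ℝ) ^ d * (2 * r + 1 : ℝ) ^ d * S.card * P *
    Real.exp (-(m * ((ρ : ℝ) - 2 * r))) with ha
  have ha0 : 0 ≤ a := by positivity
  -- the single-flip bound
  have hstep : ∀ (ζ : Site d → ℤˣ), ∀ y ∈ (rOuterBoundary r A).filter (· ∈ B),
      |(U.spec β A (spinFlip y ζ)).real E - (U.spec β A ζ).real E| ≤ a * (U.spec β A ζ).real E := by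
    intro ζ y hy
    obtain ⟨hyBd, hyB⟩ := Finset.mem_filter.1 hy
    have hyA : y ∉ A := (mem_rOuterBoundary.1 hyBd).1
    obtain ⟨A', hA'O, hNy, hNz, hρy, hP, hSMT⟩ := hbox y hy
    have hA'A : A' ⊆ A := hA'O.trans Finset.inter_subset_left
    -- the covariance constants in `A ∩ B`
    set cst : ℝ := R * R * R ^ 2 * (2 * r + 1 : ℝ) ^ d * (2 * r + 1 : ℝ) ^ d * P *
      Real.exp (-(m * ((ρ : ℝ) - 2 * r))) with hcst
    have hc : ∀ z ∈ (rOuterBoundary r (A \ (A \ B))).filter (· ∈ A), ∀ ξ : Site d → ℤˣ,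
        |∫ ω, flipWeight U β A y ω * flipWeight U β (A \ (A \ B)) z ω ∂(U.spec β (A \ (A \ B)) ξ) -
          (∫ ω, flipWeight U β A y ω ∂(U.spec β (A \ (A \ B)) ξ)) *
            ∫ ω, flipWeight U β (A \ (A \ B)) z ω ∂(U.spec β (A \ (A \ B)) ξ)| ≤ cst := by
      rw [hsd]
      intro z hz ξ
      have h := abs_cov_le_of_SMT_subvolume U β hR1 hR (W := A ∩ B) (A := A') hA'O (x := y) (y := z)
        (fun w hw hwO => hNy w hw hwO) (fun w hw => hNz z hz w hw) (ρ := ρ) (fun w hw => hρy w hw)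
        (measurable_flipWeight U β A y) (measurable_flipWeight U β (A ∩ B) z)
        (dependsOn_flipWeight U β A y) (dependsOn_flipWeight U β (A ∩ B) z) (hvB A y) (hvB _ z) hm hl hSMT ξ
      refine h.trans ?_
      rw [hcst]
      have hPc : (((rOuterBoundary r A').filter (· ∈ A ∩ B)).card : ℝ) ≤ P := by exact_mod_cast hP
      gcongr
    have hxA₀ : ∀ z ∈ A \ B, r < supDist z y := fun z hz => hsep y hy z hz
    have hT : ∀ z ∈ T, z ∈ A → z ∈ A \ B := fun z hz hzA => Finset.mem_sdiff.2 ⟨hzA, hTB z hz⟩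
    have hyT : y ∉ T := fun h => hTB y h hyB
    have h := abs_spec_real_spinFlip_sub_le_mul_real U β hR1 hR (A := A) (A₀ := A \ B) hyA hxA₀ hE hET hT hyT
      hc ζ
    refine h.trans (mul_le_mul_of_nonneg_right ?_ measureReal_nonneg)
    rw [Finset.sum_const, nsmul_eq_mul, hsd, ha, hcst]
    exact le_of_eq (by ring)
  exact abs_spec_real_sub_union_le_mul_real U β hE hET (fun z hz hzB => (hTB z hz hzB).elim) ha0 hstep hκ τ

end Glauber

end Literature.Probability.LatticeModels

end
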